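import Summits.HubbardSuperconductivity.HubbardSuperconductivity.Theorems.AnisotropyChordTransferFibre3KernelWindow
import Summits.HubbardSuperconductivity.HubbardSuperconductivity.Theorems.AnisotropyChordTransferFibre3GreenZero

/-!
# Route `AnisotropyChord` / H0 rotor rung: PartN37 — the exact λ-HARMONICITY of the torus kernel (`KernelHarmonicity`, `KernelAxisValue`) PROVED

Typed targets `KernelHarmonicity`, `KernelAxisValue` of `…Fibre3KernelWindow` (PORT PartN37 v2, theory seat
`hubbard-h0-rotor-theory-1` g21, memo 21 §315; p2's port p739260).  With `g(k) = 1/(2ε(k) − λ)` off `k = 0`,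
`G̃(r) = (1/V)Σ_k g(k) cos(k·r)`, `a(r) = G̃(0) − G̃(r)`:
* `sum_nn_Gres`: `Σ_e G̃(x+e) = (4 − λ)G̃(x) − δ_{x,0} + 1/V` (`Σ_e e^{ik·e} = 4 − 2ε(k)`, `(4 − 2ε)g = (4 − λ)g − 1` off the
  zero mode, `Σ_k cos(k·x) = Vδ_{x,0}`), for `0 ≤ λ < 2ε₁`;
* **`kernelHarmonicity_holds : KernelHarmonicity L`**, and — with the lattice symmetries of `a` (`aKer_neg`, `aKer_swap`) —
  **`kernelAxisValue_holds : KernelAxisValue L`** (`a(1,0) = (1 − 1/V + λG̃(0))/4`).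
Prover seat `hubbard-h0-rotor-p1` g23; helper for stmt-HubbardSuperconductivity-19089 (`--supports`).
-/

set_option linter.dupNamespace false
set_option autoImplicit false

noncomputable section

open scoped BigOperators
open Complex

namespace Summit.HubbardSuperconductivity.HubbardSuperconductivity.Theorems.AnisotropyChord.Transfer.Fibre3

variable (L : ℕ) [NeZero L]

/-- `Σ_k Re φ_k(x) = V·δ_{x,0}`. [folklore] -/
theorem sum_re_phase (x : Tor L) : ∑ k : Tor L, (phase L k x).re = if x = 0 then (L : ℝ) ^ 2 else 0 := by
  rw [← Complex.re_sum, sum_phase_left]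
  split_ifs
  · rw [show ((L : ℂ)) ^ 2 = (((L : ℝ) ^ 2 : ℝ) : ℂ) by push_cast; ring, Complex.ofReal_re]
  · simp

/-- `Σ_{e} Re φ_k(x+e) = (4 − 2ε(k))·Re φ_k(x)` over the four nearest neighbours. [folklore] -/
theorem nn_sum_re_phase (k x : Tor L) :
    (phase L k (x + ex L)).re + (phase L k (x + -ex L)).re + (phase L k (x + ey L)).re + (phase L k (x + -ey L)).re
      = (4 - 2 * epsT L k) * (phase L k x).re := by
  have h : phase L k (x + ex L) + phase L k (x + -ex L) + phase L k (x + ey L) + phase L k (x + -ey L)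
      = phase L k x * ((4 - 2 * epsT L k : ℝ) : ℂ) := by
    rw [phase_add, phase_add, phase_add, phase_add, ← sum_phase_nn]; ring
  have h' := congrArg Complex.re h
  simp only [Complex.add_re, Complex.mul_re, Complex.ofReal_re, Complex.ofReal_im, mul_zero, sub_zero] at h'
  rw [h']; ring

/-- off the zero mode `(4 − 2ε(k))·g(k) = (4 − λ)g(k) − 1`; on it both sides read through `g(0) = 0`. [folklore] -/
theorem gres_mul_four_sub (hL : 2 ≤ L) {lam2 : ℝ} (hlam : lam2 < 2 * eps1 L) (k : Tor L) :
    gres L lam2 k * (4 - 2 * epsT L k) = (4 - lam2) * gres L lam2 k - (if k = 0 then (0 : ℝ) else 1) := by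
  unfold gres
  by_cases hk : k = 0
  · simp [hk]
  · rw [if_neg hk, if_neg hk]
    have hε := eps1_le_epsT L hL hk
    have hne : 2 * epsT L k - lam2 ≠ 0 := by linarith
    field_simp
    ring

/-- **the kernel is λ-harmonic:** `Σ_e G̃(x+e) = (4 − λ)G̃(x) − δ_{x,0} + 1/V` (`0 ≤ λ < 2ε₁`). [folklore] -/
theorem sum_nn_Gres (hL : 2 ≤ L) {lam2 : ℝ} (hlam : lam2 < 2 * eps1 L) (x : Tor L) :
    Gres L lam2 (x + ex L) + Gres L lam2 (x + -ex L) + Gres L lam2 (x + ey L) + Gres L lam2 (x + -ey L)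
      = (4 - lam2) * Gres L lam2 x - (if x = 0 then (1 : ℝ) else 0) + 1 / (L : ℝ) ^ 2 := by
  have hV : (0 : ℝ) < (L : ℝ) ^ 2 := by
    have : (0 : ℝ) < L := by exact_mod_cast Nat.pos_of_ne_zero (NeZero.ne L)
    positivity
  unfold Gres
  rw [← add_div, ← add_div, ← add_div, ← Finset.sum_add_distrib, ← Finset.sum_add_distrib, ← Finset.sum_add_distrib]
  have hk : ∀ k : Tor L, gres L lam2 k * (phase L k (x + ex L)).re + gres L lam2 k * (phase L k (x + -ex L)).re
      + gres L lam2 k * (phase L k (x + ey L)).re + gres L lam2 k * (phase L k (x + -ey L)).re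
      = (4 - lam2) * (gres L lam2 k * (phase L k x).re) - (if k = 0 then (0 : ℝ) else 1) * (phase L k x).re := by
    intro k
    have h1 := nn_sum_re_phase L k x
    have h2 := gres_mul_four_sub L hL hlam k
    calc gres L lam2 k * (phase L k (x + ex L)).re + gres L lam2 k * (phase L k (x + -ex L)).re
          + gres L lam2 k * (phase L k (x + ey L)).re + gres L lam2 k * (phase L k (x + -ey L)).re
        = gres L lam2 k * ((4 - 2 * epsT L k) * (phase L k x).re) := by rw [← h1]; ring
      _ = (gres L lam2 k * (4 - 2 * epsT L k)) * (phase L k x).re := by ring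
      _ = _ := by rw [h2]; ring
  rw [Finset.sum_congr rfl fun k _ => hk k, Finset.sum_sub_distrib, ← Finset.mul_sum]
  have hind : ∑ k : Tor L, (if k = 0 then (0 : ℝ) else 1) * (phase L k x).re
      = (if x = 0 then (L : ℝ) ^ 2 else 0) - 1 := by
    have e : ∀ k : Tor L, (if k = 0 then (0 : ℝ) else 1) * (phase L k x).re
        = (phase L k x).re - (if k = 0 then (phase L k x).re else 0) := by
      intro k; split_ifs <;> ring
    rw [Finset.sum_congr rfl fun k _ => e k, Finset.sum_sub_distrib, sum_re_phase, Finset.sum_ite_eq' Finset.univ (0 : Tor L)]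
    simp only [Finset.mem_univ, if_true, phase_zero_left, Complex.one_re]
  rw [hind]
  field_simp
  split_ifs <;> ring

/-- ★ **`KernelHarmonicity` holds.** [folklore] -/
theorem kernelHarmonicity_holds : KernelHarmonicity L := by
  intro lam2 h0 hlam x
  by_cases hL : 2 ≤ L
  · rw [nnList_map_sum]
    unfold aKer
    have h := sum_nn_Gres L hL hlam x
    linarith
  · -- `L = 1`: `ε₁ = 0`, the hypotheses are contradictory
    exfalso
    have hL1 : L = 1 := by have := NeZero.ne L; omega
    have : eps1 L = 0 := by
      unfold eps1; rw [hL1]; simp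
    rw [this] at hlam
    linarith

/-! ## The lattice symmetries of the kernel and the axis value -/

/-- `ε(−k) = ε(k)`. [folklore] -/
theorem epsT_neg (k : Tor L) : epsT L (-k) = epsT L k := by
  have h1 := sum_phase_nn L k
  have h2 := sum_phase_nn L (-k)
  rw [phase_neg_left, phase_neg_left, phase_neg_left, phase_neg_left, neg_neg, neg_neg] at h2
  have : ((4 - 2 * epsT L (-k) : ℝ) : ℂ) = ((4 - 2 * epsT L k : ℝ) : ℂ) := by
    rw [← h1, ← h2]; ring
  have := Complex.ofReal_injective this
  linarith

/-- `G̃(−r) = G̃(r)`. [folklore] -/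
theorem Gres_neg (lam2 : ℝ) (r : Tor L) : Gres L lam2 (-r) = Gres L lam2 r := by
  unfold Gres
  congr 1
  refine Finset.sum_congr rfl fun k _ => ?_
  rw [← conj_phase, Complex.conj_re]

omit [NeZero L] in
/-- `ε(k₂,k₁) = ε(k₁,k₂)`. [folklore] -/
theorem epsT_swap (k : Tor L) : epsT L (k.2, k.1) = epsT L k := by
  unfold epsT; ring

/-- `φ_{(k₂,k₁)}((r₂,r₁)) = φ_k(r)`. [folklore] -/
theorem phase_swap_swap (k r : Tor L) : phase L (k.2, k.1) (r.2, r.1) = phase L k r := by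
  rw [phase_eq_phZ, phase_eq_phZ]
  congr 1
  unfold dotZ
  ring

/-- `G̃((r₂,r₁)) = G̃((r₁,r₂))`. [folklore] -/
theorem Gres_swap (lam2 : ℝ) (r : Tor L) : Gres L lam2 (r.2, r.1) = Gres L lam2 r := by
  unfold Gres
  congr 1
  refine Fintype.sum_equiv (Equiv.prodComm (ZMod L) (ZMod L)) _ _ fun k => ?_
  simp only [Equiv.prodComm_apply, Prod.swap]
  have hg : gres L lam2 (k.2, k.1) = gres L lam2 k := by
    unfold gres
    have : ((k.2, k.1) : Tor L) = 0 ↔ k = 0 := by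
      constructor
      · intro h
        have h1 := congrArg Prod.fst h; have h2 := congrArg Prod.snd h
        simp only [Prod.fst_zero, Prod.snd_zero] at h1 h2
        exact Prod.ext h2 h1
      · intro h; rw [h]; rfl
    simp only [this, epsT_swap]
  have hp := phase_swap_swap L (k.2, k.1) r
  simp only [Prod.mk.eta] at hp
  rw [hp, hg]

/-- ★ **`KernelAxisValue` holds:** `a(1,0) = (1 − 1/V + λG̃(0))/4` for `0 ≤ λ < 2ε₁`. [folklore] -/
theorem kernelAxisValue_holds : KernelAxisValue L := by
  refine kernelAxisValue_of_harmonicity L (kernelHarmonicity_holds L) ?_ rfl ?_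
  · intro lam2 e he
    unfold nnList at he
    simp only [List.mem_cons, List.mem_nil_iff, or_false] at he
    unfold aKer
    rcases he with h | h | h | h <;> rw [h]
    · rw [show (((-1 : ZMod L), (0 : ZMod L)) : Tor L) = -((1 : ZMod L), 0) by ext <;> simp, Gres_neg]
    · have : (((0 : ZMod L), (1 : ZMod L)) : Tor L) = ((((1 : ZMod L), (0 : ZMod L)) : Tor L).2, (((1 : ZMod L), (0 : ZMod L)) : Tor L).1) := rfl
      rw [this, Gres_swap]
    · rw [show (((0 : ZMod L), (-1 : ZMod L)) : Tor L) = -((0 : ZMod L), 1) by ext <;> simp, Gres_neg]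
      have : (((0 : ZMod L), (1 : ZMod L)) : Tor L) = ((((1 : ZMod L), (0 : ZMod L)) : Tor L).2, (((1 : ZMod L), (0 : ZMod L)) : Tor L).1) := rfl
      rw [this, Gres_swap]
  · intro lam2; unfold aKer; ring

end Summit.HubbardSuperconductivity.HubbardSuperconductivity.Theorems.AnisotropyChord.Transfer.Fibre3

end
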